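import Summits.CriticalPhenomena.PercolationContinuityZ3.Theorems.Transplant.GrigorchukLamplighterShortCycles
import Mathlib.Combinatorics.SimpleGraph.Maps
import HarnessLib

/-!
# The Cayley graph `Cay(ℤ ≀_X 𝔊; a, b, c, d, s)`: adjacency-defined edge classes (triangle edges, `T`-cornered squares, alternating returns), their
# invariance under automorphisms, and the census `IsA` = `a`, `IsT` = `{b,c,d}`, `IsS` = `s^{±1}` (label rigidity, part I)

builds on p205010 (kernel theorem, internal audit signed; external expert review pending) — nothing in this file uses p205010; graph theory of ONE Cayley
graph, no percolation statement, nothing about any `@[conjecture]`.  Lane `prim-bschramm`, seat `prim-bschramm-p3` gen 36 (DESIGN OWNER;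
`P3-NILPOTENT.md` §29.1–29.2).  Helper file (`--supports stmt-CriticalPhenomena-4575 --as helper`).

THE CENSUS (refuter conditions (2a)/(2b), lead g25 ruling O14; order tri → sq → alt8 → alt16).  On `G = Cay(Γ₂; {a,b,c,d,s})` (`Grigorchuk.Cay`, the
right Cayley graph `mulCayley stdGens`) define, from adjacency ALONE (hence invariant under every `G ≃g G`):
* `TriE u v` (a common neighbour) — holds at an edge `u — u·y` iff `y ∈ {b,c,d}` (the `K₄` on `u·{1,b,c,d}`; no product of two letters is `a` or `s`);
* `SqT u v` (a 4-cycle `u v w z` whose corners `v—w`, `u—z` are `TriE`-edges) — holds at `s^{±1}`-edges (`s` commutes with `b`), fails at `a`-edges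
  (`a t y ≠ t′`); so `IsT` = tree letters, `IsS` = lamp letters, `IsA` = the letter `a`;
* `Alt8 u v` (a closed 8-walk `T A T A T A T A` from `u` through `v`) — holds at `d`-edges (`(da)⁴ = 1`), fails at `b`/`c`-edges (the 54 words of
  «GrigorchukFiniteModel»); `Alt16` (closed 16-walk alternating `T ∧ ¬Alt8` / `A`) — holds at `c`-edges (`(ca)⁸ = 1`), fails at `b`-edges (the 128 words).
THIS FILE: §1 the graph `Cay` and its neighbours (`cay_adj_iff`: right multiples by the six letter codes `L6` of «GrigorchukLamplighterShortCycles»); §2 the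
predicates `TriE`, `SqT`, `IsT/IsA/IsS`, `AltRet`, `Alt8`, `IsBC`, `Alt16` for ANY simple graph and their invariance under `G ≃g G`; §3 the census of
`TriE`/`SqT` on `Cay` and the classification of neighbours (`eq_of_isA`, `exists_of_isT`, `eq_of_isS`).  The alternating walks and the main theorem
`cay_label_rigid` are the sequel «GrigorchukLamplighterLabelRigidity».
[cite: BartholdiErschler2012, §2–§3.1] [cite: BenjaminiSchramm1996, §2 (Cayley graphs)] [cite: Grigorchuk1980, relations of 𝔊]
-/

noncomputable section

namespace Summit.CriticalPhenomena.PercolationContinuityZ3.Theorems.Transplant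

namespace Grigorchuk

open SimpleGraph SemidirectProduct
open scoped Classical

/-! ### §1 The graph and its neighbours -/

/-- **Bartholdi–Erschler's Cayley graph** `Cay(ℤ ≀_X 𝔊; a, b, c, d, s)` (right Cayley graph of the standard generating set).
[cite: BartholdiErschler2012, §2 (standard generating set)] -/
def Cay : SimpleGraph ↥wreathZ := mulCayley (↑stdGens : Set ↥wreathZ)

/-- **Neighbours are right multiples by the six letters.** [cite: BenjaminiSchramm1996, §2 (Cayley graphs)] -/
theorem cay_adj_iff {u w : ↥wreathZ} : Cay.Adj u w ↔ ∃ y : L6, w = u * y.toW := by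
  constructor
  · intro h
    obtain ⟨x, -, hx, rfl⟩ := CayleyCosets.exists_letter_of_adj stdGens h
    obtain ⟨y, rfl⟩ := mem_stdGens_or_inv_iff.1 hx
    exact ⟨y, rfl⟩
  · rintro ⟨y, rfl⟩
    exact CayleyCosets.adj_mul_letter stdGens (mem_stdGens_or_inv_iff.2 ⟨y, rfl⟩) (toW_ne_one y)

/-- `u — u·y` for every code `y`. [folklore] -/
theorem cay_adj_mul (u : ↥wreathZ) (y : L6) : Cay.Adj u (u * y.toW) := cay_adj_iff.2 ⟨y, rfl⟩

/-- The inverse of a letter is a letter. [folklore] -/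
theorem exists_toW_inv (y : L6) : ∃ y' : L6, (y.toW)⁻¹ = y'.toW := by
  cases y
  · exact ⟨.a, letters_inv.1⟩
  · exact ⟨.b, letters_inv.2.1⟩
  · exact ⟨.c, letters_inv.2.2.1⟩
  · exact ⟨.d, letters_inv.2.2.2⟩
  · exact ⟨.si, rfl⟩
  · exact ⟨.s, inv_inv _⟩

/-! ### §2 The adjacency-defined predicates and their invariance -/

section Predicates

variable {V : Type} (G : SimpleGraph V)

/-- The edge `u — v` has a common neighbour (lies in a triangle). [folklore] -/
def TriE (u v : V) : Prop := ∃ w, G.Adj u w ∧ G.Adj v w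

/-- A `T`-cornered 4-cycle through `u — v`: neighbours `w` of `v` and `z` of `u` along triangle-edges, with `w — z`. [folklore] -/
def SqT (u v : V) : Prop := ∃ w z, G.Adj v w ∧ TriE G v w ∧ G.Adj u z ∧ TriE G u z ∧ G.Adj w z

/-- Class `T` (will be: tree letters `b, c, d`). [folklore] -/
def IsT (u v : V) : Prop := G.Adj u v ∧ TriE G u v

/-- Class `A` (will be: the letter `a`). [folklore] -/
def IsA (u v : V) : Prop := G.Adj u v ∧ ¬ TriE G u v ∧ ¬ SqT G u v

/-- Class `S` (will be: the lamp letters `s^{±1}`). [folklore] -/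
def IsS (u v : V) : Prop := G.Adj u v ∧ ¬ TriE G u v ∧ SqT G u v

/-- An alternating return: `n` more pairs (`P`-edge then `A`-edge) from `x` ending at `y`. [folklore] -/
def AltRet (P : V → V → Prop) : ℕ → V → V → Prop
  | 0, x, y => x = y
  | n + 1, x, y => ∃ v w, P x v ∧ IsA G v w ∧ AltRet P n w y

/-- A closed 8-walk `T A T A T A T A` from `u` whose first edge is `u — v`. [folklore] -/
def Alt8 (u v : V) : Prop := IsT G u v ∧ ∃ w, IsA G v w ∧ AltRet G (IsT G) 3 w u

/-- Class `T ∧ ¬Alt8` (will be: the letters `b, c`). [folklore] -/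
def IsBC (u v : V) : Prop := IsT G u v ∧ ¬ Alt8 G u v

/-- A closed 16-walk alternating `IsBC`-edges and `A`-edges from `u` whose first edge is `u — v`. [folklore] -/
def Alt16 (u v : V) : Prop := IsBC G u v ∧ ∃ w, IsA G v w ∧ AltRet G (IsBC G) 7 w u

variable {G}

/-- Invariance of `TriE` under automorphisms. [folklore] -/
theorem TriE.map (φ : G ≃g G) {u v : V} (h : TriE G u v) : TriE G (φ u) (φ v) := by
  obtain ⟨w, h1, h2⟩ := h
  exact ⟨φ w, φ.map_adj_iff.2 h1, φ.map_adj_iff.2 h2⟩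

/-- `TriE` is automorphism-invariant. [folklore] -/
theorem triE_map_iff (φ : G ≃g G) {u v : V} : TriE G (φ u) (φ v) ↔ TriE G u v := by
  refine ⟨fun h => ?_, TriE.map φ⟩
  have h' := TriE.map φ.symm h
  rwa [φ.symm_apply_apply, φ.symm_apply_apply] at h'

/-- Invariance of `SqT`. [folklore] -/
theorem SqT.map (φ : G ≃g G) {u v : V} (h : SqT G u v) : SqT G (φ u) (φ v) := by
  obtain ⟨w, z, h1, h2, h3, h4, h5⟩ := h
  exact ⟨φ w, φ z, φ.map_adj_iff.2 h1, h2.map φ, φ.map_adj_iff.2 h3, h4.map φ, φ.map_adj_iff.2 h5⟩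

/-- `SqT` is automorphism-invariant. [folklore] -/
theorem sqT_map_iff (φ : G ≃g G) {u v : V} : SqT G (φ u) (φ v) ↔ SqT G u v := by
  refine ⟨fun h => ?_, SqT.map φ⟩
  have h' := SqT.map φ.symm h
  rwa [φ.symm_apply_apply, φ.symm_apply_apply] at h'

/-- `IsT` is automorphism-invariant. [folklore] -/
theorem isT_map_iff (φ : G ≃g G) {u v : V} : IsT G (φ u) (φ v) ↔ IsT G u v := by
  unfold IsT; rw [φ.map_adj_iff, triE_map_iff]

/-- `IsA` is automorphism-invariant. [folklore] -/
theorem isA_map_iff (φ : G ≃g G) {u v : V} : IsA G (φ u) (φ v) ↔ IsA G u v := by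
  unfold IsA; rw [φ.map_adj_iff, triE_map_iff, sqT_map_iff]

/-- `IsS` is automorphism-invariant. [folklore] -/
theorem isS_map_iff (φ : G ≃g G) {u v : V} : IsS G (φ u) (φ v) ↔ IsS G u v := by
  unfold IsS; rw [φ.map_adj_iff, triE_map_iff, sqT_map_iff]

/-- Invariance of alternating returns, for an invariant `P`. [folklore] -/
theorem altRet_map_iff {P : V → V → Prop} (φ : G ≃g G) (hP : ∀ u v, P (φ u) (φ v) ↔ P u v) :
    ∀ (n : ℕ) {x y : V}, AltRet G P n (φ x) (φ y) ↔ AltRet G P n x y := by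
  intro n
  induction n with
  | zero => intro x y; exact φ.injective.eq_iff
  | succ n ih =>
    intro x y
    constructor
    · rintro ⟨v, w, h1, h2, h3⟩
      refine ⟨φ.symm v, φ.symm w, ?_, ?_, ?_⟩
      · rw [← hP, φ.apply_symm_apply]; exact h1
      · rw [← isA_map_iff φ, φ.apply_symm_apply, φ.apply_symm_apply]; exact h2
      · rw [← ih, φ.apply_symm_apply]; exact h3
    · rintro ⟨v, w, h1, h2, h3⟩
      exact ⟨φ v, φ w, (hP _ _).2 h1, (isA_map_iff φ).2 h2, ih.2 h3⟩

/-- `Alt8` is automorphism-invariant. [folklore] -/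
theorem alt8_map_iff (φ : G ≃g G) {u v : V} : Alt8 G (φ u) (φ v) ↔ Alt8 G u v := by
  unfold Alt8
  rw [isT_map_iff]
  refine and_congr_right fun _ => ⟨?_, ?_⟩
  · rintro ⟨w, h1, h2⟩
    refine ⟨φ.symm w, ?_, ?_⟩
    · rw [← isA_map_iff φ, φ.apply_symm_apply]; exact h1
    · rw [← altRet_map_iff φ (fun _ _ => isT_map_iff φ) 3, φ.apply_symm_apply]; exact h2
  · rintro ⟨w, h1, h2⟩
    exact ⟨φ w, (isA_map_iff φ).2 h1, (altRet_map_iff φ (fun _ _ => isT_map_iff φ) 3).2 h2⟩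

/-- `IsBC` is automorphism-invariant. [folklore] -/
theorem isBC_map_iff (φ : G ≃g G) {u v : V} : IsBC G (φ u) (φ v) ↔ IsBC G u v := by
  unfold IsBC; rw [isT_map_iff, alt8_map_iff]

/-- `Alt16` is automorphism-invariant. [folklore] -/
theorem alt16_map_iff (φ : G ≃g G) {u v : V} : Alt16 G (φ u) (φ v) ↔ Alt16 G u v := by
  unfold Alt16
  rw [isBC_map_iff]
  refine and_congr_right fun _ => ⟨?_, ?_⟩
  · rintro ⟨w, h1, h2⟩
    refine ⟨φ.symm w, ?_, ?_⟩
    · rw [← isA_map_iff φ, φ.apply_symm_apply]; exact h1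
    · rw [← altRet_map_iff φ (fun _ _ => isBC_map_iff φ) 7, φ.apply_symm_apply]; exact h2
  · rintro ⟨w, h1, h2⟩
    exact ⟨φ w, (isA_map_iff φ).2 h1, (altRet_map_iff φ (fun _ _ => isBC_map_iff φ) 7).2 h2⟩

end Predicates

/-! ### §3 The census: identification of the classes on `Cay` -/

/-- **Triangles sit exactly on the tree letters**: `TriE (u, u·y)` iff `y ∈ {b, c, d}`. [folklore] -/
theorem triE_iff (u : ↥wreathZ) (y : L6) : TriE Cay u (u * y.toW) ↔ y.isTree = true := by
  constructor
  · rintro ⟨w, h1, h2⟩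
    obtain ⟨z, rfl⟩ := cay_adj_iff.1 h1
    obtain ⟨z', hz'⟩ := cay_adj_iff.1 h2
    -- `z = y z'`, so `y = z z'⁻¹ = z z''`
    obtain ⟨z'', hz''⟩ := exists_toW_inv z'
    have e1 : z.toW = y.toW * z'.toW := mul_left_cancel (by rw [← mul_assoc]; exact hz')
    have e : y.toW = z.toW * z''.toW := by rw [← hz'', e1, mul_inv_cancel_right]
    cases y
    · exact absurd e.symm (letter_mul_ne_aW z z'')
    · rfl
    · rfl
    · rfl
    · exact absurd e.symm (letter_mul_ne_sW z z'')
    · exfalso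
      -- `s⁻¹ = z z'' ⟹ s = z''⁻¹ z⁻¹`, again a product of two letters
      obtain ⟨z₁, hz₁⟩ := exists_toW_inv z
      obtain ⟨z₂, hz₂⟩ := exists_toW_inv z''
      refine letter_mul_ne_sW z₂ z₁ ?_
      rw [← hz₁, ← hz₂, ← mul_inv_rev, ← e, L6.toW, inv_inv]
  · intro hy
    -- witnesses from the Klein table
    cases y
    · exact absurd hy (by decide)
    · exact ⟨u * cW, cay_adj_mul u .c, by
        have : u * cW = u * bW * dW := by rw [mul_assoc, klein.2.2.1]
        rw [this]; exact cay_adj_mul _ .d⟩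
    · exact ⟨u * bW, cay_adj_mul u .b, by
        have : u * bW = u * cW * dW := by rw [mul_assoc, klein.2.2.2.2.1]
        rw [this]; exact cay_adj_mul _ .d⟩
    · exact ⟨u * bW, cay_adj_mul u .b, by
        have : u * bW = u * dW * cW := by rw [mul_assoc, klein.2.2.2.2.2]
        rw [this]; exact cay_adj_mul _ .c⟩
    · exact absurd hy (by decide)
    · exact absurd hy (by decide)

/-- **`T`-cornered squares through the lamp edges**: `SqT (u, u·s)` and `SqT (u, u·s⁻¹)` (`s` commutes with `b`). [folklore] -/
theorem sqT_lamp (u : ↥wreathZ) : SqT Cay u (u * sW) ∧ SqT Cay u (u * sW⁻¹) := by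
  have hsb : sW⁻¹ * bW = bW * sW⁻¹ := by
    rw [inv_mul_eq_iff_eq_mul, ← mul_assoc, sW_comm.1, mul_assoc, mul_inv_cancel, mul_one]
  constructor
  · refine ⟨u * sW * bW, u * bW, cay_adj_mul _ .b, (triE_iff _ .b).2 rfl, cay_adj_mul _ .b, (triE_iff _ .b).2 rfl, ?_⟩
    have : u * sW * bW = u * bW * sW := by rw [mul_assoc, sW_comm.1, mul_assoc]
    rw [this]; exact (cay_adj_mul (u * bW) .s).symm
  · refine ⟨u * sW⁻¹ * bW, u * bW, cay_adj_mul _ .b, (triE_iff _ .b).2 rfl, cay_adj_mul _ .b, (triE_iff _ .b).2 rfl, ?_⟩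
    have : u * sW⁻¹ * bW = u * bW * sW⁻¹ := by rw [mul_assoc, hsb, mul_assoc]
    rw [this]; exact (cay_adj_mul (u * bW) .si).symm

/-- **No `T`-cornered square through an `a`-edge** (`a t y ≠ t′`). [folklore] -/
theorem not_sqT_a (u : ↥wreathZ) : ¬ SqT Cay u (u * aW) := by
  rintro ⟨w, z, h1, h2, h3, h4, h5⟩
  obtain ⟨t, rfl⟩ := cay_adj_iff.1 h1
  obtain ⟨t', rfl⟩ := cay_adj_iff.1 h3
  obtain ⟨y, hy⟩ := cay_adj_iff.1 h5
  have ht := (triE_iff _ t).1 h2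
  have ht' := (triE_iff _ t').1 h4
  refine aW_tree_letter_ne t y t' ht ht' ?_
  have := hy; rw [mul_assoc u, mul_assoc u] at this
  exact (mul_left_cancel this).symm

/-- **The classes of the six edges at a vertex**: `IsA` at `a`, `IsT` at `b, c, d`, `IsS` at `s^{±1}`. [folklore] -/
theorem classes (u : ↥wreathZ) : IsA Cay u (u * aW) ∧ (∀ y : L6, y.isTree = true → IsT Cay u (u * y.toW)) ∧
    IsS Cay u (u * sW) ∧ IsS Cay u (u * sW⁻¹) := by
  refine ⟨⟨cay_adj_mul u .a, fun h => absurd ((triE_iff u .a).1 h) (by decide), not_sqT_a u⟩,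
    fun y hy => ⟨cay_adj_mul u y, (triE_iff u y).2 hy⟩,
    ⟨cay_adj_mul u .s, fun h => absurd ((triE_iff u .s).1 h) (by decide), (sqT_lamp u).1⟩,
    ⟨cay_adj_mul u .si, fun h => absurd ((triE_iff u .si).1 h) (by decide), (sqT_lamp u).2⟩⟩

/-- **An `A`-neighbour is `u·a`.** [folklore] -/
theorem eq_of_isA {u w : ↥wreathZ} (h : IsA Cay u w) : w = u * aW := by
  obtain ⟨hadj, hntri, hnsq⟩ := h
  obtain ⟨y, rfl⟩ := cay_adj_iff.1 hadj
  cases y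
  · rfl
  · exact absurd ((triE_iff u .b).2 rfl) hntri
  · exact absurd ((triE_iff u .c).2 rfl) hntri
  · exact absurd ((triE_iff u .d).2 rfl) hntri
  · exact absurd (sqT_lamp u).1 hnsq
  · exact absurd (sqT_lamp u).2 hnsq

/-- **A `T`-neighbour is `u·t` for a tree letter.** [folklore] -/
theorem exists_of_isT {u w : ↥wreathZ} (h : IsT Cay u w) : ∃ y : L6, y.isTree = true ∧ w = u * y.toW := by
  obtain ⟨hadj, htri⟩ := h
  obtain ⟨y, rfl⟩ := cay_adj_iff.1 hadj
  exact ⟨y, (triE_iff u y).1 htri, rfl⟩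

/-- **An `S`-neighbour is `u·s^{±1}`.** [folklore] -/
theorem eq_of_isS {u w : ↥wreathZ} (h : IsS Cay u w) : w = u * sW ∨ w = u * sW⁻¹ := by
  obtain ⟨hadj, hntri, hsq⟩ := h
  obtain ⟨y, rfl⟩ := cay_adj_iff.1 hadj
  cases y
  · exact absurd hsq (not_sqT_a u)
  · exact absurd ((triE_iff u .b).2 rfl) hntri
  · exact absurd ((triE_iff u .c).2 rfl) hntri
  · exact absurd ((triE_iff u .d).2 rfl) hntri
  · exact Or.inl rfl
  · exact Or.inr rfl

end Grigorchuk

end Summit.CriticalPhenomena.PercolationContinuityZ3.Theorems.Transplant
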